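import Literature.RepresentationTheory.FiniteGroups.GL2ModularPrincipalSeriesCoordDuality
import Summits.BirchSwinnertonDyer.BirchSwinnertonDyer.Theorems.TeichmullerTwistDescentTypeLatticeNoCaseOne
import Summits.BirchSwinnertonDyer.BirchSwinnertonDyer.Theorems.TeichmullerTwistDescentDefs
import HarnessLib

/-!
# Route `TeichmullerTwistDescent`, crux K `TwistedPeriodLatticeSaturation` (stmt-BirchSwinnertonDyer-25368):
# «case one» excluded by a COHOMOLOGY-side tame-type lattice datum (socle = the Serre weight `C_W`)

Cell `pub/bsd-wall` (D-0145 line route-BirchSwinnertonDyer-TeichmullerTwistDescent, OPEN rev 7), seat `bsd-line-ttd-p1`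
(prover 1/2, g22).  THEOREMS ONLY (no definition, no named fact, no `sorry`).  BSD is not proved by this file; K is NOT
proved; sequel of `TeichmullerTwistDescentTypeLatticeNoCaseOne` (homology-side datum).

WHY.  In the audited mechanism (ttd-p1 g19 `AUDIT-K-MECHANISM` §1 (S4)–(S8)) the weights-in-cohomology input (I3)+(I4)
is a statement about the COHOMOLOGY lattice `Λ_Q^{*} ↪ H¹(Y(K(p)K₀(M)), ℤ_p)_𝔪`: «every simple `GL₂(𝔽_p)`-submodule of its
reduction is the Serre weight `C_W = Sym^{p−1−2b} ⊗ det^b`», i.e. `Λ_Q^*` lies in the lattice class `L₀` of the type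
`Ind(ω̃ᵇ ⊗ ω̃^{−b})`, while the period maps land in the HOMOLOGY-quotient lattice `Λ_Q` (class `L₁`, socle `C′`), the
`ℤ_p`-dual.  The invariant pairing `Ind(χ) × Ind(χ⁻¹) → ℤ_p` is the dot product of Bruhat coordinates
(`GL2ModularPrincipalSeriesCoordDuality`), so the homology-side lattice is the dot-product dual
`dualLattice Λc (p^m)` of the cohomology-side lattice `Λc ⊆ coordRep (ω̃ᵇ) (ω̃^{p−1−b})`.  This file runs the glue with
the datum stated on `Λc`: EGS uniqueness (`subrepresentation_coordRep_eq_pow_smul_top`, p729687) pins `Λc = pᶜ·⊤`, the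
dual is then `p^{m−c}·⊤` (`dualLattice_smul_top`) and the twisting/Stickelberger argument of the homology-side file
applies verbatim.

* `teichmullerChar_pow_inv` — `(ω̃ᵇ)⁻¹ = ω̃^{p−1−b}` (so `coordRep (ω̃ᵇ)⁻¹ (ω̃^{p−1−b})⁻¹` is the homology model);
* `le_of_pow_smul_top_le` — `p^m·⊤ ⊆ pᶜ·⊤ ⟹ c ≤ m`;
* **`not_caseOne_of_cohomologyTypeLatticeDatum`** — data: `Λc` (finite index, `ReductionSocleLe … (p−1−2b) Λc`, i.e.
  socle `⊆ {Sym^{p−1−2b} ⊗ χ̄₁∘det}` with `χ̄₁ = ωᵇ` = `C_W`), `βW : Λf → dualLattice Λc (p^m) ∩ 𝓑^T`,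
  `βV : Λfχ →` coords with `dualLattice Λc (p^m) ∩ 𝓑^{T,χ∘det} ⊆ span(range βV)`, `βW(g·w) = T_χ(βV w)`; then
  «case one» is false;
* `saturation_at_of_cohomologyDatum` (p ≥ 11, K's binders) and `…_of_five_le` (p ≥ 5) — the K-conclusion at an instance.
-/

set_option autoImplicit false
-- single-conjunct summit: `Summit.BirchSwinnertonDyer.BirchSwinnertonDyer.…` repeats the name by design
set_option linter.dupNamespace false

noncomputable section

open scoped Pointwise

open Function
open Literature.RepresentationTheory.FiniteGroups Literature.RepresentationTheory.FiniteGroups.GL2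
  Literature.NumberTheory.GaussSums Literature.NumberTheory.EllipticCurves.ModularForms
open Literature.NumberTheory.EllipticCurves (Kato2004.teichmullerChar Kato2004.teichmullerChar_pow_sub_one)

namespace Summit.BirchSwinnertonDyer.BirchSwinnertonDyer.Theorems.TeichmullerTwistDescent.TypeLatticeCohomologySide

section Prelim

variable (p : ℕ) [hp : Fact p.Prime]

/-- `(ω̃ᵇ)⁻¹ = ω̃^{p−1−b}` for `b ≤ p − 1`. [cite: Lang1990, Ch. 1 §2] -/
theorem teichmullerChar_pow_inv {b : ℕ} (hb : b ≤ p - 1) :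
    (Kato2004.teichmullerChar p ^ b)⁻¹ = Kato2004.teichmullerChar p ^ (p - 1 - b) :=
  MonoidHom.ext fun a => by
    rw [MonoidHom.inv_apply, MonoidHom.pow_apply, MonoidHom.pow_apply]
    exact inv_eq_of_mul_eq_one_right
      (by rw [← pow_add, Nat.add_sub_cancel' hb, Kato2004.teichmullerChar_pow_sub_one])

/-- `p^m·⊤ ⊆ pᶜ·⊤` in a coordinate module over `ℤ_p` with a nonempty index type forces `c ≤ m`.
[cite: EmertonGeeSavitt2015, Lemma 4.1.1] -/
theorem le_of_pow_smul_top_le {ι : Type*} (i₀ : ι) {m c : ℕ}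
    (h : ((p : ℤ_[p]) ^ m • (⊤ : Submodule ℤ_[p] (ι → ℤ_[p]))) ≤ (p : ℤ_[p]) ^ c • ⊤) : c ≤ m := by
  have hmem : (p : ℤ_[p]) ^ m • (fun _ : ι => (1 : ℤ_[p])) ∈ (p : ℤ_[p]) ^ c • (⊤ : Submodule ℤ_[p] (ι → ℤ_[p])) :=
    h (Submodule.smul_mem_pointwise_smul _ _ _ Submodule.mem_top)
  obtain ⟨w, -, hw⟩ := (Submodule.mem_smul_pointwise_iff_exists _ _ _).mp hmem
  have h0 := congrFun hw i₀
  simp only [Pi.smul_apply, smul_eq_mul, mul_one] at h0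
  have hdvd : (p : ℤ_[p]) ^ c ∣ (p : ℤ_[p]) ^ m := ⟨w i₀, h0.symm⟩
  exact (pow_dvd_pow_iff (NeZero.ne _) (PadicInt.irreducible_p (p := p)).not_isUnit).mp hdvd

end Prelim

section NoCaseOne

variable (p : ℕ) [hp : Fact p.Prime] {k : Type} [Field k] [CharP k p] [Algebra ℤ_[p] k] [Finite k]

/-- **«Case one» is excluded by a COHOMOLOGY-side tame-type lattice datum.**  Data: `p` odd, `0 < b`, `2b < p − 1`;
a residue field `k` of `ℤ_p` through `toZMod`; `Λc` a `GL₂(𝔽_p)`-stable `ℤ_p`-lattice of finite index (`p^m·⊤ ⊆ Λc`) in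
the cohomology model `coordRep (ω̃ᵇ) (ω̃^{p−1−b})` whose reduction has socle `⊆ {Sym^{p−1−2b} ⊗ ωᵇ∘det}` — the Serre
weight `C_W` — (`ReductionSocleLe`, the hypothesis of the lattice theorem with `r = p − 1 − 2b`); additive maps
`βW : Λf →` the `T`-invariants of the dual lattice `dualLattice Λc (p^m)` (for the dot product) and `βV : Λfχ →` coords
whose image spans over the `χ∘det`-line of the dual lattice, intertwining `βW(g·w) = T_χ(βV w)` (torus data and `T_χ`
of the HOMOLOGY model `coordRep (ω̃^{p−1−b}) (ω̃ᵇ)`).  Then `∀ w ∈ Λfχ, ∃ z ∈ Λf, g w = p z` is impossible: EGS pins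
`Λc = pᶜ·⊤`, its dual is `p^{m−c}·⊤`, and the divisibility criterion gives `p ∣ J(ω̃^{b+(p−1)/2}, ω̃^{(p−1)/2})`, a
unit.  [cite: EmertonGeeSavitt2015, Lemma 4.1.1] [cite: Lang1990, Ch. 1 §2 Thm. 2.1] [cite: Bump1997, §4.1 Prop. 4.1.1] -/
theorem not_caseOne_of_cohomologyTypeLatticeDatum (hp2 : p ≠ 2) {b : ℕ} (hb : 0 < b) (hb2 : 2 * b < p - 1)
    (hsurj : Surjective (algebraMap ℤ_[p] k))
    (halg : ∀ x : ℤ_[p], algebraMap ℤ_[p] k x = ZMod.castHom (dvd_refl p) k (PadicInt.toZMod x))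
    (Λc : Subrepresentation
      (coordRep (Kato2004.teichmullerChar p ^ b) (Kato2004.teichmullerChar p ^ (p - 1 - b)))) {m : ℕ}
    (hm : ∀ v : Option (ZMod p) → ℤ_[p], (p : ℤ_[p]) ^ m • v ∈ Λc)
    (hsoc : ReductionSocleLe p k (Kato2004.teichmullerChar p ^ b) (Kato2004.teichmullerChar p ^ (p - 1 - b))
      (p - 1 - 2 * b) Λc)
    {Λf Λfχ : AddSubgroup ℂ} (g : ℂ) (hframe : ∀ w ∈ Λfχ, g * w ∈ Λf)
    (βW : Λf →+ (Option (ZMod p) → ℤ_[p])) (βV : Λfχ →+ (Option (ZMod p) → ℤ_[p]))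
    (hβW : ∀ z : Λf, βW z ∈ dualLattice Λc.toSubmodule ((p : ℤ_[p]) ^ m) ⊓
      coordTorusEigenspace (Kato2004.teichmullerChar p ^ (p - 1 - b)) (Kato2004.teichmullerChar p ^ b)
        (fun _ _ => (1 : ℤ_[p])))
    (hβV : dualLattice Λc.toSubmodule ((p : ℤ_[p]) ^ m) ⊓
        coordTorusEigenspace (Kato2004.teichmullerChar p ^ (p - 1 - b)) (Kato2004.teichmullerChar p ^ b)
          (fun a c : (ZMod p)ˣ => MulChar.ofUnitHom (Kato2004.teichmullerChar p ^ ((p - 1) / 2)) (a : ZMod p) *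
            MulChar.ofUnitHom (Kato2004.teichmullerChar p ^ ((p - 1) / 2)) (c : ZMod p)) ≤
      Submodule.span ℤ_[p] (Set.range βV))
    (hβ : ∀ (w : ℂ) (hw : w ∈ Λfχ), βW ⟨g * w, hframe w hw⟩ =
      coordTwistOp (Kato2004.teichmullerChar p ^ (p - 1 - b)) (Kato2004.teichmullerChar p ^ b)
        (MulChar.ofUnitHom (Kato2004.teichmullerChar p ^ ((p - 1) / 2))) (βV ⟨w, hw⟩))
    (hcase : ∀ w ∈ Λfχ, ∃ z ∈ Λf, g * w = (p : ℂ) * z) : False := by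
  -- (1) EGS: `Λc = p^c • ⊤` in the cohomology model (`χ₁ = ω̃ᵇ`, `χ₂ = ω̃^{p−1−b}`, `r = p−1−2b`)
  obtain ⟨c, hc⟩ := subrepresentation_coordRep_eq_pow_smul_top p (Kato2004.teichmullerChar p ^ b)
    (Kato2004.teichmullerChar p ^ (p - 1 - b)) (ϖ := (p : ℤ_[p])) (NeZero.ne _)
    (padicInt_eq_zero_of_forall_pow_dvd p)
    (padicInt_algebraMap_eq_zero_iff p (padicInt_ker_eq_maximalIdeal p hsurj)) hsurj
    (reduceChar_teichmullerChar_pow_ne p halg (i := b) (j := p - 1 - b) (r := p - 1 - 2 * b) (by omega) (by omega)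
      (by omega))
    (reduceChar_teichmullerChar_pow_rel p halg (i := b) (j := p - 1 - b) (r := p - 1 - 2 * b) (by omega))
    (s := 2 * b) (by omega) Λc hm hsoc
  -- (2) `c ≤ m` and the dual lattice is `p^{m-c} • ⊤`
  have hcm : c ≤ m := le_of_pow_smul_top_le p (none : Option (ZMod p))
    (by rw [← hc]; intro v hv; obtain ⟨w, -, rfl⟩ := (Submodule.mem_smul_pointwise_iff_exists _ _ _).mp hv; exact hm w)
  have hdual : dualLattice Λc.toSubmodule ((p : ℤ_[p]) ^ m) =
      (p : ℤ_[p]) ^ (m - c) • (⊤ : Submodule ℤ_[p] (Option (ZMod p) → ℤ_[p])) := by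
    rw [hc, show (p : ℤ_[p]) ^ m = (p : ℤ_[p]) ^ c * (p : ℤ_[p]) ^ (m - c) by rw [← pow_add, Nat.add_sub_cancel' hcm]]
    exact dualLattice_smul_top (pow_ne_zero c (NeZero.ne _)) _
  rw [hdual] at hβW hβV
  -- (3) the homology-side criterion
  have hne := TypeLatticeNoCaseOne.quadratic_ne_of_exponents p hp2 hb hb2
  have hdvd : (p : ℤ_[p]) ∣ jacobiSum (MulChar.ofUnitHom (Kato2004.teichmullerChar p ^ b) *
      MulChar.ofUnitHom (Kato2004.teichmullerChar p ^ ((p - 1) / 2)))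
      (MulChar.ofUnitHom (Kato2004.teichmullerChar p ^ ((p - 1) / 2))) := by
    refine dvd_jacobiSum_of_span_le_of_map_mem (Kato2004.teichmullerChar p ^ (p - 1 - b))
      (Kato2004.teichmullerChar p ^ b) (TypeLatticeNoCaseOne.teichmullerChar_pow_mul_pow_eq_one p (by omega))
      (TypeLatticeNoCaseOne.teichmullerChar_pow_sub_ne_one p hb (by omega))
      (ofUnitHom_teichmullerChar_pow_half_inv p hp2) hne.1 hne.2 (pow_ne_zero (m - c) (NeZero.ne _)) (p : ℤ_[p])
      (Set.range βV) hβV ?_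
    rintro _ ⟨⟨w, hw⟩, rfl⟩
    obtain ⟨z, hz, hgw⟩ := hcase w hw
    have hgz : (⟨g * w, hframe w hw⟩ : Λf) = (p : ℕ) • (⟨z, hz⟩ : Λf) := by
      apply Subtype.ext
      show g * w = (((p : ℕ) • (⟨z, hz⟩ : Λf) : Λf) : ℂ)
      rw [AddSubgroupClass.coe_nsmul, nsmul_eq_mul, hgw]
    rw [← hβ w hw, hgz, map_nsmul, ← Nat.cast_smul_eq_nsmul ℤ_[p]]
    exact Submodule.smul_mem_pointwise_smul _ _ _ (hβW ⟨z, hz⟩)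
  exact (PadicInt.irreducible_p (p := p)).not_isUnit
    (isUnit_of_dvd_unit hdvd (isUnit_jacobiSum_teichmuller_quadratic_of_two_mul_lt p hp2 hb hb2))

end NoCaseOne

end Summit.BirchSwinnertonDyer.BirchSwinnertonDyer.Theorems.TeichmullerTwistDescent.TypeLatticeCohomologySide
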